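import Summits.AtomisticToContinuum.FouriersLaw.Theorems.BondHeatUncertaintyExtensiveSnapshotIrreversibilityEnergyWindowHessianSplitC

/-!
# Bond heat uncertainty — node «HessianSplit», part D: the score dual bound (MD₂) and the
  Malliavin integration-by-parts interface (MW₂) beneath the weighted `W^{2,1}` leaf (KD₂)

CONTENTS.  After parts A/main/B/C the one quantitative leaf beneath S3 `KernelTemperatureLipschitz`
is (KD₂) `LyapunovWeightedDensitySobolev₂` (weighted `L¹(dy)` bounds on the four bath-momentum
derivatives `Dᵢ ∈ {∂_{x_b}p, ∂²_{x_b}p, ∂_{y_b}p, ∂²_{y_b}p}` of the smooth density `p(s,z,y)` at a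
FIXED time `s ∈ [½, 1]`).  This file TYPES the two statements one level below it (critic row
1170 (c)) and proves the calculus they need; part E proves the reductions:
* (MD₂) `DensityScoreDualBound₂` — the Wiener-free DUAL form: for every `1 < r` and `ε > 0` there
  are `δ₀ > 0`, `C ≥ 0` with `|∫ G Dᵢ dy| ≤ (∫ |G|^r p(s,z,y) dy)^{1/r} · C e^{εH(z)}` for all
  SMOOTH compactly supported test functions `G` (`|δ| < δ₀`, `s ∈ [½,1]`, both baths, all `z`):
  by `L^r/L^q` duality (and density of `C_c^∞`, `Dᵢ` being continuous) exactly «the four SCORES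
  `Dᵢ/p` lie in `L^q(p dy)`, `q = r/(r−1)`, with norm `≤ C e^{εH(z)}`» — the norms of the
  conditioned Malliavin weights `E[Φᵢ | X_s^z]`.
* (MW₂) `MalliavinIBPWeights₂` — the probabilistic interface asked for by the critic: four WEIGHTS
  `Φ₀ … Φ₃ ∈ L^q(Ω)` on the tree's Wiener pair with `E|Φᵢ|^q ≤ (C e^{εH(z)})^q` and the identities
  `∫ G Dᵢ dy = E[G(X_s^z) Φᵢ]` for smooth compactly supported `G` (Nualart Prop. 2.1.4 shape),
  `X_s^z = solMap s z (pairPath ·)` the tree's strong solution (`law X_s^z = p(s,z,y) dy`,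
  `pinnedChain_transitionKernel_apply`); departure `Φ₀, Φ₁`: Bismut–
  Elworthy–Li weights, arrival `Φ₂, Φ₃`: Kusuoka–Stroock weights `H_α(X_s, 1)`.  (MW₂) ⟹ (MD₂) is
  Hölder on `Ω` (part E); conversely (MD₂) gives (MW₂) with `Φᵢ = (Dᵢ/p)(s,z,X_s^z)` (Riesz; not
  needed, not proved) — the same analytic content, (MD₂) being the form a finite-dimensional
  (skeleton) Gaussian calculus proves WITHOUT a limit object: the inequality at each level, then
  limits of NUMBERS.
* calculus (PROVED): the four derivatives `densityDeriv` are smooth in `y` (`contDiff_densityDeriv`,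
  sections of the joint jet), monotone exhaustion by balls, and the smooth sign approximant
  `|t| ≤ t²/√(t²+η²) + η` used by part E to test (MD₂) with smooth functions only.
* part E: ★ (MD₂) → (KD₂), ★ (MW₂) → (MD₂), ★★ `kernelTemperatureLipschitz_of_scoreDual : (Dˢ) →
  (MD₂) → S3` (junction of record proposed) and the (MW₂) junctions.

TEST CLASS.  Smooth compactly supported `G` — the SMALLEST natural class (weakest statements): for
such `G` the identities of (MW₂) are the textbook `E[∂ᵅG(X_s)] = ±E[G(X_s)Φ]` (Nualart Prop. 2.1.4)
/ `∂ᵅ_z E[G(X_s^z)] = E[G Φ]`, i.e. exactly what a finite-dimensional (skeleton) Gaussian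
integration by parts delivers; the density/regularisation step (`sgn Dᵢ` is not smooth) is done
in the PROVED reduction (part E), not left to the leaf.  NON-JUNK: `Φ ≡ 0` or `C = 0` forces
`Dᵢ ≡ 0`; every integral in (MD₂)/(MW₂) is a genuine (finite) one.

POTENTIAL CLASS / SOURCES (refuter's pre-registered attack point).  `pinnedChain ω₂ lam β γ`:
pinning `U = ω₂q²/2 + lam q⁴/4`, coupling `V = r²/2 + βr⁴/4`, all parameters `> 0` — pinning and
coupling of EQUAL degree 4, `V'' ≥ 1` (CEHR C1–C5; NOT the stiff-pinning regime `deg U > deg V` of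
Hairer–Mattingly 2009).  Hörmander / smoothness: CEHR Prop. 3.2 (tree, `isTransitionDensity
_exists`); Eckmann–Pillet–Rey-Bellet 1999 §3, Rey-Bellet–Thomas 2002, Carmona 2007 (`deg V ≥
deg U`).  Load-bearing and NOT in print as stated: inverse moments of the Malliavin covariance of
`X_s^z`, `s ≥ ½`, growing at most SUB-EXPONENTIALLY in `H(z)` (`∀ ε`) — Hairer–Mattingly 2011
Thm 6.7 shape (polynomial hypoelliptic SDE with Lyapunov structure; brackets of uniform depth
through `V'' ≥ 1`).  [both NEW · STRONGER than (KD₂) · ATTACKABLE-XL]  MUST-FAIL (probes): (MD₂),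
(MW₂) ↛ S3, ↛ (Dˢ); (KD₂) ↛ (MD₂); CEHR (3.4)/tree ↛ (KD₂).  No short-time rate anywhere; nothing
of the dormant (SWM) shape (fixed `s ≥ ½`; the moment bounds carry no `s`).
-/

noncomputable section

namespace Summit.AtomisticToContinuum.FouriersLaw.Theorems.ExtensiveSnapshotIrreversibility.EnergyWindow

open MeasureTheory Filter Topology Real Set Metric
open scoped ENNReal NNReal ContDiff
open Literature.MathematicalPhysics.KineticTheory.HeatConduction Literature.Probability.Process
open Literature.Analysis.FunctionSpaces

variable {N : ℕ}

/-! ## 1. The four density derivatives; the statements (MW₂) and (MD₂) -/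

/-- The four bath-momentum derivatives of a density `p` entering (KD₂), indexed by `Fin 4`:
`0 ↦ ∂_{x_b}p(s,·,y)(z)`, `1 ↦ ∂²_{x_b}p(s,·,y)(z)` (departure), `2 ↦ ∂_{y_b}p(s,z,·)(y)`,
`3 ↦ ∂²_{y_b}p(s,z,·)(y)` (arrival), as functions of the arrival point `y`. [folklore] -/
def densityDeriv (p : ℝ → PhaseSpace N → PhaseSpace N → ℝ) (s : ℝ) (b : Fin N)
    (z : PhaseSpace N) : Fin 4 → PhaseSpace N → ℝ :=
  ![fun y => partialP b (fun x => p s x y) z, fun y => partialP b (partialP b fun x => p s x y) z,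
    fun y => partialP b (p s z) y, fun y => partialP b (partialP b (p s z)) y]

/-- `densitySobolevSum₂ = Σᵢ |Dᵢ|`. [folklore] -/
theorem densitySobolevSum₂_eq_sum (p : ℝ → PhaseSpace N → PhaseSpace N → ℝ) (s : ℝ) (b : Fin N)
    (z y : PhaseSpace N) : densitySobolevSum₂ p s b z y = ∑ i, |densityDeriv p s b z i y| := by
  simp only [densitySobolevSum₂, densityDeriv, Fin.sum_univ_four, Matrix.cons_val_zero,
    Matrix.cons_val_one, Matrix.cons_val]

/-- **(MW₂) `MalliavinIBPWeights₂`** — the Malliavin integration-by-parts interface beneath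
(KD₂) `LyapunovWeightedDensitySobolev₂` (critic row 1170 (c)): for positive parameters, `T > 0`,
`N ≥ 2`, every exponent `1 < q` and every `ε > 0` there are `δ₀ > 0`, `C ≥ 0` such that for all
`|δ| < δ₀` (incl. `δ = 0`), every jointly smooth density `p` of the kernels with baths `T ± δ/2`
(`IsTransitionDensity`), every fixed `s ∈ [½, 1]`, both bath sites `b` and every `z` there are four
WEIGHTS `Φ₀ … Φ₃ : Ω → ℝ` on the Wiener pair with `Φᵢ ∈ L^q`, `E|Φᵢ|^q ≤ (C e^{εH(z)})^q`, and, for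
every smooth compactly supported `G`, `∫ G(y) Dᵢ(y) dy = E[G(X_s^z) Φᵢ]` — `Dᵢ` the
four bath-momentum derivatives `densityDeriv` of `p` (departure `∂_{x_b}, ∂²_{x_b}` at `z`: Bismut–
Elworthy–Li weights; arrival `∂_{y_b}, ∂²_{y_b}`: Kusuoka–Stroock weights; signs absorbed),
`X_s^z(w) = solMap s z (pairPath w)` the tree's strong solution (law `p(s,z,y)dy`).  Load-bearing:
inverse moments of the Malliavin covariance at `s ≥ ½` growing sub-exponentially in `H(z)`
(Hairer–Mattingly 2011 Thm 6.7 shape) for the equal-degree quartic chain (CEHR C1–C5, `V'' ≥ 1`);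
Hörmander/smoothness is CEHR Prop 3.2 (tree).  ALL `q < ∞` are consumed downstream.  Implies
(KD₂); ↛ S3, ↛ (Dˢ); not implied by (KD₂) (probes).  [NEW · STRONGER than (KD₂) · ATTACKABLE-XL]
(after CuneoEckmannHairerReyBellet2018, Prop. 3.2, §3 eq. (3.4)) (after HairerMattingly2011spde, Thm 6.7) [route leaf · named hypothesis of this cell, NOT filed as a route item here] -/
def MalliavinIBPWeights₂ : Prop :=
  ∀ ω₂ lam β γ : ℝ, 0 < ω₂ → 0 < lam → 0 < β → 0 < γ →
    ∀ T : ℝ, 0 < T → ∀ (N : ℕ) (hN : 2 ≤ N), ∀ q ε : ℝ, 1 < q → 0 < ε →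
      ∃ δ₀ C : ℝ, 0 < δ₀ ∧ 0 ≤ C ∧ ∀ δ : ℝ, |δ| < δ₀ →
        ∀ p : ℝ → PhaseSpace N → PhaseSpace N → ℝ,
          IsTransitionDensity ω₂ lam β γ N (T + δ / 2) (T - δ / 2) p →
          ∀ s : ℝ, 1 / 2 ≤ s → s ≤ 1 → ∀ b : Fin N, (b = leftBath N hN ∨ b = rightBath N hN) →
            ∀ z : PhaseSpace N, ∃ Φ : Fin 4 → WienerPair → ℝ,
              (∀ i, MemLp (Φ i) (ENNReal.ofReal q) wienerPair ∧
                ∫ w, |Φ i w| ^ q ∂wienerPair ≤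
                  (C * Real.exp (ε * (pinnedChain ω₂ lam β γ).hamiltonian N z)) ^ q) ∧
              ∀ G : PhaseSpace N → ℝ, ContDiff ℝ ∞ G → HasCompactSupport G → ∀ i : Fin 4,
                ∫ y, G y * densityDeriv p s b z i y =
                  ∫ w, G ((pinnedChain ω₂ lam β γ).solMap N (T + δ / 2) (T - δ / 2) s z
                    (pairPath w)) * Φ i w ∂wienerPair


/-- **(MD₂) `DensityScoreDualBound₂`** — the Wiener-free dual form of the Malliavin layer beneath
(KD₂): for positive parameters, `T > 0`, `N ≥ 2`, every exponent `1 < r` and every `ε > 0` there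
are `δ₀ > 0`, `C ≥ 0` such that for all `|δ| < δ₀` (incl. `δ = 0`), every jointly smooth density
`p` of the kernels with baths `T ± δ/2` (`IsTransitionDensity`), every fixed `s ∈ [½, 1]`, both
bath sites `b`, every `z` and every SMOOTH compactly supported test function `G`:
`|∫ G(y) Dᵢ(y) dy| ≤ (∫ |G(y)|^r p(s,z,y) dy)^{1/r} · C e^{εH(z)}` for the four bath-momentum
derivatives `Dᵢ = densityDeriv p s b z i`.  Equivalently (Riesz; `Dᵢ` continuous): the scores have
`L^q(P_s(z,dy))`-norm `≤ C e^{εH(z)}`, `q = r/(r−1)` — ALL `q < ∞`, sub-exponential growth in the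
energy, uniform in `|δ| < δ₀`, `s ∈ [½,1]`; these are the norms of the conditioned Bismut /
Kusuoka–Stroock weights `E[Φᵢ | X_s^z]` of (MW₂).  Implied by (MW₂) (Hölder, part E); implies
(KD₂) (below); ↛ S3, ↛ (Dˢ); not implied by (KD₂) (probes).  The natural target of the tree's
finite-dimensional skeleton Gaussian integration by parts: the inequality at each level and
regularisation, then a limit of NUMBERS.  Load-bearing input and potential class: as for (MW₂).
[NEW · STRONGER than (KD₂) · WEAKER than (MW₂) · ATTACKABLE-XL]
(after CuneoEckmannHairerReyBellet2018, Prop. 3.2, §3 eq. (3.4)) (after Nualart2006, Prop. 2.1.4) (after HairerMattingly2011spde, Thm 6.7) [route leaf · named hypothesis of this cell, NOT filed as a route item here] -/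
def DensityScoreDualBound₂ : Prop :=
  ∀ ω₂ lam β γ : ℝ, 0 < ω₂ → 0 < lam → 0 < β → 0 < γ →
    ∀ T : ℝ, 0 < T → ∀ (N : ℕ) (hN : 2 ≤ N), ∀ r ε : ℝ, 1 < r → 0 < ε →
      ∃ δ₀ C : ℝ, 0 < δ₀ ∧ 0 ≤ C ∧ ∀ δ : ℝ, |δ| < δ₀ →
        ∀ p : ℝ → PhaseSpace N → PhaseSpace N → ℝ,
          IsTransitionDensity ω₂ lam β γ N (T + δ / 2) (T - δ / 2) p →
          ∀ s : ℝ, 1 / 2 ≤ s → s ≤ 1 → ∀ b : Fin N, (b = leftBath N hN ∨ b = rightBath N hN) →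
            ∀ z : PhaseSpace N, ∀ G : PhaseSpace N → ℝ, ContDiff ℝ ∞ G → HasCompactSupport G →
              ∀ i : Fin 4,
                |∫ y, G y * densityDeriv p s b z i y| ≤
                  (∫ y, |G y| ^ r * p s z y) ^ (1 / r) *
                    (C * Real.exp (ε * (pinnedChain ω₂ lam β γ).hamiltonian N z))

/-! ## 2. Lemmas: monotone exhaustion by balls, smoothness of the four derivatives, the sign
  approximant -/

/-- If `g ≥ 0` is continuous and `∫ 1_{|y| ≤ n} g ≤ B` for every `n`, then `g ∈ L¹` with
`∫ g ≤ B` (monotone convergence over the exhausting balls). [folklore] -/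
theorem integrable_and_integral_le_of_indicator_closedBall {g : PhaseSpace N → ℝ}
    (hg : Continuous g) (hg0 : ∀ y, 0 ≤ g y) {B : ℝ}
    (hB : ∀ n : ℕ, ∫ y, (closedBall (0 : PhaseSpace N) n).indicator g y ≤ B) :
    Integrable g ∧ ∫ y, g y ≤ B := by
  have hKi : ∀ n : ℕ, Integrable ((closedBall (0 : PhaseSpace N) n).indicator g) := fun n =>
    (hg.continuousOn.integrableOn_compact (isCompact_closedBall _ _)).integrable_indicator
      measurableSet_closedBall
  have hind0 : ∀ n : ℕ, ∀ y, 0 ≤ (closedBall (0 : PhaseSpace N) n).indicator g y := fun n y =>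
    Set.indicator_nonneg (fun y _ => hg0 y) _
  have hB0 : 0 ≤ B := (integral_nonneg (hind0 0)).trans (hB 0)
  set F : ℕ → PhaseSpace N → ℝ≥0∞ := fun n y =>
    ENNReal.ofReal ((closedBall (0 : PhaseSpace N) n).indicator g y) with hF
  have hFm : ∀ n, Measurable (F n) := fun n =>
    (hg.measurable.indicator measurableSet_closedBall).ennreal_ofReal
  have hFmono : Monotone F := fun m n hmn y =>
    ENNReal.ofReal_le_ofReal (Set.indicator_le_indicator_of_subset
      (closedBall_subset_closedBall (by exact_mod_cast hmn)) (fun y => hg0 y) y)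
  have hsup : ∀ y, (⨆ n, F n y) = ENNReal.ofReal (g y) := by
    intro y
    apply le_antisymm
    · exact iSup_le fun n => ENNReal.ofReal_le_ofReal (Set.indicator_le_self' (fun _ _ => hg0 y) y)
    · refine le_iSup_of_le ⌈‖y‖⌉₊ (le_of_eq ?_)
      rw [hF]; dsimp only; rw [Set.indicator_of_mem (mem_closedBall_zero_iff.2 (Nat.le_ceil _))]
  have hle : ∫⁻ y, ENNReal.ofReal (g y) ≤ ENNReal.ofReal B := by
    rw [show (fun y => ENNReal.ofReal (g y)) = fun y => ⨆ n, F n y from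
      funext fun y => (hsup y).symm, lintegral_iSup hFm hFmono]
    refine iSup_le fun n => ?_
    rw [hF]; dsimp only; rw [← ofReal_integral_eq_lintegral_ofReal (hKi n) (ae_of_all _ (hind0 n))]
    exact ENNReal.ofReal_le_ofReal (hB n)
  refine ⟨⟨hg.aestronglyMeasurable,
    (hasFiniteIntegral_iff_ofReal (ae_of_all _ hg0)).2 (hle.trans_lt ENNReal.ofReal_lt_top)⟩, ?_⟩
  rw [integral_eq_lintegral_of_nonneg_ae (ae_of_all _ hg0) hg.aestronglyMeasurable]
  exact ENNReal.toReal_le_of_le_ofReal hB0 hle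

/-- The four density derivatives are smooth in the arrival point (joint smoothness of the density;
for the departure derivatives, smoothness of sections of the joint jet). [folklore] -/
theorem contDiff_densityDeriv {ω₂ lam β γ T_L T_R : ℝ}
    {p : ℝ → PhaseSpace N → PhaseSpace N → ℝ} (hp : IsTransitionDensity ω₂ lam β γ N T_L T_R p)
    {s : ℝ} (hs : 0 < s) (b : Fin N) (z : PhaseSpace N) (i : Fin 4) :
    ContDiff ℝ ∞ (densityDeriv p s b z i) := by
  have hG₀ : ContDiff ℝ ∞ fun q : PhaseSpace N × PhaseSpace N => p s q.2 q.1 :=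
    (hp.contDiff_uncurry_top hs).comp (contDiff_snd.prodMk contDiff_fst)
  have hi : ContDiff ℝ ∞ fun y : PhaseSpace N => ((y, z) : PhaseSpace N × PhaseSpace N) :=
    contDiff_prodMk_left z
  have hpy : ∀ y, ContDiff ℝ 2 fun x => p s x y := fun y =>
    (hp.contDiff_left_top hs y).of_le (WithTop.coe_le_coe.2 le_top)
  have hinf : ContDiff ℝ ∞ (p s z) := hp.contDiff_right_top hs z
  set v : PhaseSpace N := (0, Pi.single b 1) with hv
  fin_cases i
  · -- `∂_{x_b} p(s,·,y)(z)`
    show ContDiff ℝ ∞ fun y => partialP b (fun x => p s x y) z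
    have hJ : ContDiff ℝ ∞ fun q : PhaseSpace N × PhaseSpace N =>
        iteratedFDeriv ℝ 1 (fun x : PhaseSpace N => p s x q.1) q.2 :=
      contDiff_iteratedFDeriv_section_right hG₀ 1
    have hc := (ContinuousMultilinearMap.apply ℝ (fun _ : Fin 1 => PhaseSpace N) ℝ
      (fun _ => v)).contDiff.comp (hJ.comp hi)
    have e : (fun y => partialP b (fun x => p s x y) z) = fun y =>
        ContinuousMultilinearMap.apply ℝ (fun _ : Fin 1 => PhaseSpace N) ℝ (fun _ => v)
          (iteratedFDeriv ℝ 1 (fun x : PhaseSpace N => p s x y) z) := by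
      funext y
      rw [ContinuousMultilinearMap.apply_apply, iteratedFDeriv_one_apply, hv,
        partialP_eq_fderiv_apply b (((hpy y).differentiable (by norm_num)).differentiableAt)]
    rw [e]
    exact hc
  · -- `∂²_{x_b} p(s,·,y)(z)`
    show ContDiff ℝ ∞ fun y => partialP b (partialP b fun x => p s x y) z
    have hJ : ContDiff ℝ ∞ fun q : PhaseSpace N × PhaseSpace N =>
        iteratedFDeriv ℝ 2 (fun x : PhaseSpace N => p s x q.1) q.2 :=
      contDiff_iteratedFDeriv_section_right hG₀ 2
    have hc := (ContinuousMultilinearMap.apply ℝ (fun _ : Fin 2 => PhaseSpace N) ℝ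
      ![v, v]).contDiff.comp (hJ.comp hi)
    have e : (fun y => partialP b (partialP b fun x => p s x y) z) = fun y =>
        ContinuousMultilinearMap.apply ℝ (fun _ : Fin 2 => PhaseSpace N) ℝ ![v, v]
          (iteratedFDeriv ℝ 2 (fun x : PhaseSpace N => p s x y) z) := by
      funext y
      rw [ContinuousMultilinearMap.apply_apply, hv, partialP_partialP_eq_iteratedFDeriv b (hpy y) z]
    rw [e]
    exact hc
  · -- `∂_{y_b} p(s,z,·)`
    show ContDiff ℝ ∞ fun y => partialP b (p s z) y
    exact contDiff_partialP hinf (m := ∞) (by exact_mod_cast le_top) b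
  · -- `∂²_{y_b} p(s,z,·)`
    show ContDiff ℝ ∞ fun y => partialP b (partialP b (p s z)) y
    exact contDiff_partialP (contDiff_partialP hinf (m := ∞) (by exact_mod_cast le_top) b) (m := ∞)
      (by exact_mod_cast le_top) b

/-- The smooth sign approximant `t ↦ t/√(t² + η²)`: `|t| ≤ (t/√(t²+η²))·t + η` and
`|t/√(t²+η²)| ≤ 1`. [folklore] -/
theorem abs_le_sgnApprox_mul_add (t : ℝ) {η : ℝ} (hη : 0 < η) :
    |t| ≤ t / Real.sqrt (t ^ 2 + η ^ 2) * t + η ∧ |t / Real.sqrt (t ^ 2 + η ^ 2)| ≤ 1 := by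
  set S := Real.sqrt (t ^ 2 + η ^ 2) with hSdef
  have hS : 0 < S := Real.sqrt_pos.2 (by positivity)
  have h1 : |t| ≤ S := Real.abs_le_sqrt (le_add_of_nonneg_right (sq_nonneg η))
  have h2 : S ≤ |t| + η := by
    have h : t ^ 2 + η ^ 2 ≤ (|t| + η) ^ 2 := by nlinarith [abs_nonneg t, sq_abs t, hη.le]
    calc S ≤ Real.sqrt ((|t| + η) ^ 2) := Real.sqrt_le_sqrt h
      _ = |t| + η := Real.sqrt_sq (by positivity)
  refine ⟨?_, ?_⟩
  · have key : (|t| - η) * S ≤ t * t := by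
      nlinarith [mul_le_mul_of_nonneg_left h2 (abs_nonneg t), mul_le_mul_of_nonneg_left h1 hη.le,
        abs_mul_abs_self t]
    have h3 : |t| - η ≤ t * t / S := by rw [le_div_iff₀ hS]; exact key
    rw [div_mul_eq_mul_div]
    linarith
  · rw [abs_div, abs_of_pos hS, div_le_one hS]
    exact h1

end Summit.AtomisticToContinuum.FouriersLaw.Theorems.ExtensiveSnapshotIrreversibility.EnergyWindow

end
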